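import Mathlib
import Literature.AlgebraicGeometry.Ramification.InertiaNormalSylow
import Literature.RingTheory.CompleteLocalRings.TameAutomorphismCotangent
import Summits.ResolutionOfSingularities.ResolutionOfSingularities.Theorems.WildQuotientsWildQuotientResolutionStubBorelCore
import HarnessLib

/-!
# The lower piece `W̃` of a blow-up step and the kernels of the flag pieces (crux `WildQuotients.WildQuotientResolution`, Phase 0)

Crux stmt-ResolutionOfSingularities-15640 (`WildQuotientResolution`), line `Sketch` (card
`p-closure-sylow-separation`), registered stub `stub_phaseZeroHighDim`. Companion of
`FlagStep.hasNormalSylow_of_blowupStep` (`Theorems/…FlagStep.lean`: one equivariant blow-up step of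
Phase 0 in arbitrary embedding dimension), which concludes p-closedness of the inertia upstairs
from finite p-closed actions on the outer pieces `W̄ = W̃ mod 𝔪²`,
`W̃ = J ∩ ι⁻¹(𝔫 · ι t) = {r ∈ J | e_r ∈ 𝔫}` (`ι r = e_r · ι t`), and `𝔪/(J + 𝔪²)`. To USE it one
needs (a) the canonical finite groups through which the inertia acts on these pieces and (b) the
position of `W̃` inside `J`. This file supplies both, in the element-level language of
BorelCore/FlagCore/FlagStep:

* `exists_pieceKernel` — for a residue-preserving action `τ` and `τ`-stable ideals `K`, `L`, the
  elements moving `L` only inside `K` form a NORMAL subgroup `N`; the piece `L/K` is acted on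
  through the finite group `I/N` (take `f = QuotientGroup.mk' N` in FlagStep/FlagPieces).
* `blowupCentre_lowerPiece` — for the blow-up data `(ι, J, t)` with `J S = ι(t) S`, `t ≠ 0`:
  `W̃` is `τ`-stable, `𝔪 J ≤ W̃ ≤ J`, and `t ∉ W̃`; if moreover `J ∩ 𝔪² ⊆ 𝔪 J` (the centre is cut
  out by part of a regular system of parameters) then `t ∉ W̃ + 𝔪²`, i.e. `W̄ ⊊ J̄` — the class of
  `t` is a direction of `J̄` off `W̄`, so `dim W̄ < dim J̄` and an induction on the dimension of the
  piece can run.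

[OURS · crux stmt-ResolutionOfSingularities-15640 · helper toward `stub_phaseZeroHighDim`; folklore
local algebra, counted 0; AI-level work, weaker than expert review.]
-/

-- single-problem summit: the doubled namespace component `ResolutionOfSingularities` is forced
set_option linter.dupNamespace false

open IsLocalRing Literature.AlgebraicGeometry.Ramification Literature.RingTheory.CompleteLocalRings
open Summit.ResolutionOfSingularities.ResolutionOfSingularities.Theorems.WildQuotientResolution.BorelCore

namespace Summit.ResolutionOfSingularities.ResolutionOfSingularities.Theorems.WildQuotientResolution.FlagStepFacts

section LocalRing

variable {R : Type*} [CommRing R] {I : Type*} [Group I]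

/-- **The kernel of a flag piece is a normal subgroup.** For an action `τ` of `I` on the ring `R`
by automorphisms and `τ`-stable ideals `K`, `L`, the elements `g` with `τ g r - r ∈ K` for all
`r ∈ L` (those acting trivially on the piece `L/(K ∩ L)`) form a normal subgroup `N` of `I`; the
action of `I` on the piece factors through the finite (if `I` is) group `I/N`, the shape of the
hypotheses `f₀`, `f₂` of `FlagStep.hasNormalSylow_of_blowupStep` and `f i` of
`FlagPieces.hasNormalSylow_of_flag_pieces` (`f := QuotientGroup.mk' N`, `f g = 1 ↔ g ∈ N`).
[folklore] -/
theorem exists_pieceKernel (τ : I →* (R ≃+* R)) (K L : Ideal R)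
    (hK : ∀ (g : I), ∀ x ∈ K, τ g x ∈ K) (hL : ∀ (g : I), ∀ x ∈ L, τ g x ∈ L) :
    ∃ N : Subgroup I, N.Normal ∧ ∀ g, g ∈ N ↔ ∀ r ∈ L, τ g r - r ∈ K := by
  have hinv : ∀ (h : I) (r : R), τ h (τ h⁻¹ r) = r := fun h r => by
    rw [← RingAut.mul_apply, ← map_mul, mul_inv_cancel, map_one, RingAut.one_apply]
  let N : Subgroup I :=
    { carrier := {g | ∀ r ∈ L, τ g r - r ∈ K}
      one_mem' := by
        intro r _
        rw [map_one, RingAut.one_apply, sub_self]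
        exact zero_mem _
      mul_mem' := fun {a b} ha hb r hr => by
        have e : τ (a * b) r - r = (τ a (τ b r) - τ b r) + (τ b r - r) := by
          rw [map_mul, RingAut.mul_apply]; ring
        rw [e]
        exact add_mem (ha _ (hL b r hr)) (hb r hr)
      inv_mem' := fun {a} ha r hr => by
        have h2 : τ a (τ a⁻¹ r) - τ a⁻¹ r ∈ K := ha _ (hL a⁻¹ r hr)
        rw [hinv] at h2
        have e : τ a⁻¹ r - r = -(r - τ a⁻¹ r) := by ring
        rw [e]
        exact neg_mem h2 }
  refine ⟨N, ⟨fun g hg h r hr => ?_⟩, fun g => Iff.rfl⟩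
  have e : τ (h * g * h⁻¹) r - r = τ h (τ g (τ h⁻¹ r) - τ h⁻¹ r) := by
    rw [map_sub, hinv, map_mul, map_mul, RingAut.mul_apply, RingAut.mul_apply]
  rw [e]
  exact hK h _ (hg _ (hL _ r hr))

end LocalRing

/-- **The lower piece of a blow-up step.** Let `(R, 𝔪)` be a local ring, `(S, 𝔫)` a local domain,
`ι : R → S` an injective local homomorphism, `J` an ideal with `J S = ι(t) S` for some `t ∈ J`,
`t ≠ 0`, and `τ`, `τ₁` compatible actions of `I` on `R` (preserving `J`) and on `S`. Put `W̃ := J ∩ ι⁻¹(𝔫 · ι t)` (`= {r ∈ J | e_r ∈ 𝔫}` where `ι r = e_r ι t`; the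
`W̃` of `FlagCore.stub_flagCore` / `FlagStep.hasNormalSylow_of_blowupStep`). Then: (i) `W̃` is
`τ`-stable (`e_{τ g r} = τ₁ g (e_r) · e_{τ g t}`); (ii) `𝔪 J ≤ W̃` (`e_{a r} = ι a · e_r`,
`ι(𝔪) ⊆ 𝔫`); (iii) `t ∉ W̃` (`e_t = 1`); (iv) if `J ∩ 𝔪² ⊆ 𝔪 J` then `t ∉ W̃ + 𝔪²` — the class of
`t` lies in `J̄ = (J + 𝔪²)/𝔪²` but not in `W̄ = (W̃ + 𝔪²)/𝔪²`, so `W̄ ⊊ J̄`. [folklore] -/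
theorem blowupCentre_lowerPiece
    {R S : Type*} [CommRing R] [IsLocalRing R] [CommRing S] [IsLocalRing S] [IsDomain S]
    (ι : R →+* S) [IsLocalHom ι] (hι : Function.Injective ι)
    (J : Ideal R) (t : R) (ht : t ∈ J) (ht0 : t ≠ 0) (hgen : Ideal.map ι J = Ideal.span {ι t})
    {I : Type*} [Group I] (τ : I →* (R ≃+* R)) (τ₁ : I →* (S ≃+* S))
    (hJτ : ∀ (g : I), ∀ j ∈ J, τ g j ∈ J)
    (hcomp : ∀ (g : I) (r : R), ι (τ g r) = τ₁ g (ι r)) :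
    (∀ (g : I), ∀ r ∈ J ⊓ Ideal.comap ι (maximalIdeal S * Ideal.span {ι t}),
        τ g r ∈ J ⊓ Ideal.comap ι (maximalIdeal S * Ideal.span {ι t})) ∧
      maximalIdeal R * J ≤ J ⊓ Ideal.comap ι (maximalIdeal S * Ideal.span {ι t}) ∧
      t ∉ J ⊓ Ideal.comap ι (maximalIdeal S * Ideal.span {ι t}) ∧
      (J ⊓ maximalIdeal R ^ 2 ≤ maximalIdeal R * J →
        t ∉ J ⊓ Ideal.comap ι (maximalIdeal S * Ideal.span {ι t}) ⊔ maximalIdeal R ^ 2) := by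
  classical
  -- `u := ι t ≠ 0`; `e r` with `ι r = e r * u` for `r ∈ J` (unique since `S` is a domain)
  set u : S := ι t
  have hu0 : u ≠ 0 := fun h => ht0 (hι (by rw [map_zero]; exact h))
  have hex : ∀ r : R, ∃ a : S, r ∈ J → a * u = ι r := fun r => by
    by_cases hr : r ∈ J
    · obtain ⟨a, ha⟩ := Ideal.mem_span_singleton'.mp
        (show ι r ∈ Ideal.span {u} from hgen ▸ Ideal.mem_map_of_mem ι hr)
      exact ⟨a, fun _ => ha⟩
    · exact ⟨0, fun h => absurd h hr⟩
  choose e he using hex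
  have he_uniq : ∀ r ∈ J, ∀ a : S, a * u = ι r → e r = a := fun r hr a ha =>
    mul_right_cancel₀ hu0 ((he r hr).trans ha.symm)
  have he_t : e t = 1 := he_uniq t ht 1 (one_mul u)
  have he_add : ∀ r ∈ J, ∀ r' ∈ J, e (r + r') = e r + e r' :=
    fun r hr r' hr' => he_uniq _ (add_mem hr hr') _ (by rw [add_mul, he r hr, he r' hr', map_add])
  have he_sub : ∀ r ∈ J, ∀ r' ∈ J, e (r - r') = e r - e r' :=
    fun r hr r' hr' => he_uniq _ (sub_mem hr hr') _ (by rw [sub_mul, he r hr, he r' hr', map_sub])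
  have he_smul : ∀ (a : R), ∀ r ∈ J, e (a * r) = ι a * e r :=
    fun a r hr => he_uniq _ (Ideal.mul_mem_left _ a hr) _ (by rw [mul_assoc, he r hr, map_mul])
  -- `c g := e (τ g t)` and `e (τ g r) = τ₁ g (e r) * c g`
  have hτt : ∀ g : I, τ g t ∈ J := fun g => hJτ g t ht
  have hcu : ∀ g : I, e (τ g t) * u = τ₁ g u := fun g => by rw [he _ (hτt g), hcomp]
  have he_τ : ∀ (g : I), ∀ r ∈ J, e (τ g r) = τ₁ g (e r) * e (τ g t) := fun g r hr =>
    he_uniq _ (hJτ g r hr) _ (by rw [mul_assoc, hcu, ← map_mul, he r hr, hcomp])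
  -- membership in `W̃`
  set W : Ideal R := J ⊓ Ideal.comap ι (maximalIdeal S * Ideal.span {u}) with hWdef
  have hWmem : ∀ r ∈ J, r ∈ W ↔ e r ∈ maximalIdeal S := fun r hr => by
    constructor
    · rintro ⟨-, hr'⟩
      obtain ⟨s, hs, hsu⟩ := Ideal.mem_mul_span_singleton.mp (Ideal.mem_comap.mp hr')
      rw [he_uniq r hr s hsu]
      exact hs
    · intro her
      exact ⟨hr, Ideal.mem_comap.mpr (Ideal.mem_mul_span_singleton.mpr ⟨e r, her, he r hr⟩)⟩
  have hWJ : ∀ r ∈ W, r ∈ J := fun r hr => hr.1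
  -- (ii) `𝔪 J ≤ W̃`
  have hmJ : maximalIdeal R * J ≤ W := by
    refine Ideal.mul_le.mpr fun a ha j hj => (hWmem _ (Ideal.mul_mem_left _ a hj)).mpr ?_
    rw [he_smul a j hj]
    exact Ideal.mul_mem_right _ _ (map_nonunit ι a ha)
  -- (iii) `t ∉ W̃`
  have htW : t ∉ W := fun h => by
    have h1 : e t ∈ maximalIdeal S := (hWmem t ht).mp h
    rw [he_t] at h1
    exact (maximalIdeal.isMaximal S).ne_top ((Ideal.eq_top_iff_one _).mpr h1)
  refine ⟨fun g r hr => ?_, hmJ, htW, fun hJ2 h => ?_⟩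
  · -- (i) `W̃` is `τ`-stable
    have hrJ : r ∈ J := hWJ r hr
    refine (hWmem _ (hJτ g r hrJ)).mpr ?_
    rw [he_τ g r hrJ]
    exact Ideal.mul_mem_right _ _ (ringAut_apply_mem_maximalIdeal (τ₁ g) ((hWmem r hrJ).mp hr))
  · -- (iv) `t ∉ W̃ + 𝔪²` when `J ∩ 𝔪² ⊆ 𝔪 J`
    obtain ⟨w, hw, m, hm, hwm⟩ := Submodule.mem_sup.mp h
    have hwJ : w ∈ J := hWJ w hw
    have hmJ2 : m ∈ J := by
      have : m = t - w := by rw [← hwm]; ring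
      rw [this]; exact sub_mem ht hwJ
    have hmW : m ∈ W := hmJ (hJ2 ⟨hmJ2, hm⟩)
    exact htW (hwm ▸ add_mem hw hmW)

end Summit.ResolutionOfSingularities.ResolutionOfSingularities.Theorems.WildQuotientResolution.FlagStepFacts
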